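import Summits.Ventures.LatticeQCDFlow.Scaling.DominatedStarFreshness
import Summits.Ventures.LatticeQCDFlow.Scaling.RegenerationTagChain

/-!
HONEST FRAMING: exact (Metropolis-corrected) sampling algorithms for lattice gauge theory; figures
of merit are autocorrelation/cost numbers at stated couplings and volumes; no continuum-physics
claim.

# DominatedStarTagMarginal — ON FRESH LAWS THE STALE-SET MARGINAL OF THE DOMINATED STAR EVOLVES BY THE REGENERATION
# TAG CHAIN: AVERAGED OVER AN EXACTLY DISTRIBUTED PARTNER THE REGENERATION WEIGHT IS EXACTLY `p` (RESP. `q`), SO FROM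
# `δ_{(x, univ)}` THE TAG MARGINAL AT TIME `n` IS `δ_{univ} Qⁿ` (lean-2 GEN-25, ours)

Venture-side (OURS).  Cell `lqcd-flow` (pub-lqcd), unit `pub-lqcd-lean-2-g25`, 2026-08-27.  Chapter M (the
coupon-collector ceiling without perfect transports), file 7 (the sequel `Scaling/DominatedStarMinorization` draws
the minorisation).  Setting of `Scaling/DominatedStarFreshness` (augmented
chain `P̂`, good-tag weights `γ_r ∈ {α_r, β_r, β'_r, 0}`, exact hot sampler, stationary cold kernels) and the tag
chain `Q` of `Scaling/RegenerationTagChain` with `w₀ = w_0` (`γ̄_r ∈ {1, p, q, 0}`).  The tag marginal of `P̂` is NOT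
a lumping (the regeneration coin depends on the configuration), but ON FRESH LAWS it is: averaged over an exactly
distributed partner the regeneration weight is exactly `p` (resp. `q`) — `Σ_z λ(z,D)β_r(z) = p·Σ_z λ(z,D)` by the update
involution.

## What is proved

* §1 **`fresh_sum_regenWeight`** / **`fresh_sum_regenWeight'`** (the two averages), **`fresh_goodWeight_sum`**
  (`(Σ_z λγ_r)(𝟙{D'=σD} − 𝟙{D'=BD}) = γ̄_r(D)(Σ_z λ)(𝟙{D'=σD} − 𝟙{D'=BD})` in all four tag classes);
  **`dom_tag_step`** — for a fresh `λ`: `Σ_{z'} (λP̂)(z', D') = Σ_D (Σ_z λ(z,D))·Q(D,D')`.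
* §2 **`dom_lawAt_snd`** — from `δ_{(x, univ)}` the tag marginal at time `n` is `δ_{univ} Qⁿ` (induction with the
  freshness invariant of `Scaling/DominatedStarFreshness`).

Reading (no numerics implied): although the regeneration coin of a single move depends on the configuration, the
law of the stale set is that of an autonomous finite chain — the one analysed in `Scaling/RegenerationTagChain`.
Literature grade (cell rule): OWN CONSTRUCTION; nothing cited as a fact; no new bib keys.
-/

noncomputable section

open Finset Function
open Literature.Probability.MarkovChains

namespace Summit.Ventures.LatticeQCDFlow.Scaling

variable {S : Type*} [Fintype S] [DecidableEq S] {K m : ℕ} {μ : Fin (K + 1) → S → ℝ} {M : Fin (K + 1) → S → S → ℝ}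
  {w : Fin (K + 1) → ℝ} {t p q : ℝ}

section Minor
variable (κ : Fin m → Fin K) (φ : Fin m → Equiv.Perm S)

/-! ## §1 The tag marginal of a fresh law moves by `Q` -/

omit [DecidableEq S] in
/-- **THE FORWARD REGENERATION WEIGHT AVERAGES TO `p` OVER A FRESH HUB:** if `λ(·, D)` is fresh at `0` and
`Σ_u μ_0(u) = Σ_u μ_l(u) = 1`, then `Σ_z λ(z,D)·β_r(z) = p·Σ_z λ(z,D)`. [ours] -/
theorem fresh_sum_regenWeight [DecidableEq S] (hμ : ∀ k x, 0 < μ k x) (hμ1 : ∀ k, ∑ u, μ k u = 1)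
    {β : Fin m → (Fin (K + 1) → S) → ℝ} (hβ : ∀ r z, β r z = p * μ (κ r).succ (φ r (z 0)) / μ 0 (z 0))
    {lam : (Fin (K + 1) → S) × Finset (Fin (K + 1)) → ℝ} {D : Finset (Fin (K + 1))}
    (hlam0 : ∀ (z : Fin (K + 1) → S) (v : S), lam (update z 0 v, D) * μ 0 (z 0) = lam (z, D) * μ 0 v) (r : Fin m) :
    ∑ z, lam (z, D) * β r z = p * ∑ z, lam (z, D) := by
  have e1 : ∀ z : Fin (K + 1) → S, lam (z, D) * β r z = ∑ u, lam (update z 0 u, D) * μ 0 (z 0) * β r z := by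
    intro z
    simp_rw [hlam0 z]
    rw [← Finset.sum_mul, ← Finset.mul_sum, hμ1 0, mul_one]
  have hinv := sum_update_involution (K := K) (S := S) 0 (fun y s => lam (y, D) * μ 0 s * β r (update y 0 s))
  simp only [update_idem, update_eq_self] at hinv
  rw [sum_congr rfl (fun z _ => e1 z), hinv, Finset.mul_sum]
  refine sum_congr rfl fun z _ => ?_
  have e2 : ∀ u, lam (z, D) * μ 0 u * β r (update z 0 u) = lam (z, D) * (p * μ (κ r).succ (φ r u)) := by
    intro u
    rw [hβ, update_self]
    field_simp [(hμ 0 u).ne']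
  rw [sum_congr rfl (fun u _ => e2 u), ← Finset.mul_sum, ← Finset.mul_sum,
    Equiv.sum_comp (φ r) (fun s => μ (κ r).succ s), hμ1]
  ring

omit [DecidableEq S] in
/-- **THE REVERSE REGENERATION WEIGHT AVERAGES TO `q` OVER A FRESH COLD PARTNER:** if `λ(·, D)` is fresh at `l` and
the laws have unit mass, `Σ_z λ(z,D)·β'_r(z) = q·Σ_z λ(z,D)`. [ours] -/
theorem fresh_sum_regenWeight' [DecidableEq S] (hμ : ∀ k x, 0 < μ k x) (hμ1 : ∀ k, ∑ u, μ k u = 1)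
    {β' : Fin m → (Fin (K + 1) → S) → ℝ}
    (hβ' : ∀ r z, β' r z = q * μ 0 ((φ r).symm (z (κ r).succ)) / μ (κ r).succ (z (κ r).succ))
    {lam : (Fin (K + 1) → S) × Finset (Fin (K + 1)) → ℝ} {D : Finset (Fin (K + 1))} (r : Fin m)
    (hlaml : ∀ (z : Fin (K + 1) → S) (v : S),
      lam (update z (κ r).succ v, D) * μ (κ r).succ (z (κ r).succ) = lam (z, D) * μ (κ r).succ v) :
    ∑ z, lam (z, D) * β' r z = q * ∑ z, lam (z, D) := by
  have e1 : ∀ z : Fin (K + 1) → S, lam (z, D) * β' r z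
      = ∑ u, lam (update z (κ r).succ u, D) * μ (κ r).succ (z (κ r).succ) * β' r z := by
    intro z
    simp_rw [hlaml z]
    rw [← Finset.sum_mul, ← Finset.mul_sum, hμ1, mul_one]
  have hinv := sum_update_involution (K := K) (S := S) (κ r).succ
    (fun y s => lam (y, D) * μ (κ r).succ s * β' r (update y (κ r).succ s))
  simp only [update_idem, update_eq_self] at hinv
  rw [sum_congr rfl (fun z _ => e1 z), hinv, Finset.mul_sum]
  refine sum_congr rfl fun z _ => ?_
  have e2 : ∀ u, lam (z, D) * μ (κ r).succ u * β' r (update z (κ r).succ u) = lam (z, D) * (q * μ 0 ((φ r).symm u)) := by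
    intro u
    rw [hβ', update_self]
    field_simp [(hμ (κ r).succ u).ne']
  rw [sum_congr rfl (fun u _ => e2 u), ← Finset.mul_sum, ← Finset.mul_sum,
    Equiv.sum_comp (φ r).symm (fun s => μ 0 s), hμ1]
  ring

/-- **THE GOOD-TAG WEIGHT AVERAGES TO `γ̄_r(D) ∈ {1, p, q, 0}` WHERE IT MATTERS:** for a fresh `λ`,
`(Σ_z λ(z,D)γ_r(z,D))·(𝟙{D' = σ_r D} − 𝟙{D' = B_r D}) = γ̄_r(D)·(Σ_z λ(z,D))·(𝟙{D' = σ_r D} − 𝟙{D' = B_r D})`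
(on the class `0, l ∉ D` both sides vanish because `σ_r D = D = B_r D`). [ours] -/
theorem fresh_goodWeight_sum (hμ : ∀ k x, 0 < μ k x) (hμ1 : ∀ k, ∑ u, μ k u = 1)
    {α : Fin m → (Fin (K + 1) → S) → ℝ}
    {β : Fin m → (Fin (K + 1) → S) → ℝ} (hβ : ∀ r z, β r z = p * μ (κ r).succ (φ r (z 0)) / μ 0 (z 0))
    {β' : Fin m → (Fin (K + 1) → S) → ℝ}
    (hβ' : ∀ r z, β' r z = q * μ 0 ((φ r).symm (z (κ r).succ)) / μ (κ r).succ (z (κ r).succ))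
    {γ : Fin m → (Fin (K + 1) → S) × Finset (Fin (K + 1)) → ℝ}
    (hγ : ∀ r a, γ r a = if (0 : Fin (K + 1)) ∉ a.2 then (if (κ r).succ ∉ a.2 then α r a.1 else β r a.1)
      else (if (κ r).succ ∉ a.2 then β' r a.1 else 0))
    {gbar : Fin m → Finset (Fin (K + 1)) → ℝ}
    (hg : ∀ r D, gbar r D = if (0 : Fin (K + 1)) ∉ D then (if (κ r).succ ∉ D then (1 : ℝ) else p)
      else (if (κ r).succ ∉ D then q else 0))
    {Bset : Fin m → Finset (Fin (K + 1)) → Finset (Fin (K + 1))}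
    (hB : ∀ r D, Bset r D = if (0 : Fin (K + 1)) ∉ D ∧ (κ r).succ ∉ D then D
      else insert (0 : Fin (K + 1)) (insert (κ r).succ D))
    {lam : (Fin (K + 1) → S) × Finset (Fin (K + 1)) → ℝ} {D : Finset (Fin (K + 1))}
    (hlam : ∀ (z : Fin (K + 1) → S) (j : Fin (K + 1)) (v : S), j ∉ D →
      lam (update z j v, D) * μ j (z j) = lam (z, D) * μ j v)
    (r : Fin m) (D' : Finset (Fin (K + 1))) :
    (∑ z, lam (z, D) * γ r (z, D))
        * ((if D' = D.image (Equiv.swap (0 : Fin (K + 1)) (κ r).succ) then (1 : ℝ) else 0)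
            - (if D' = Bset r D then (1 : ℝ) else 0))
      = gbar r D * (∑ z, lam (z, D))
        * ((if D' = D.image (Equiv.swap (0 : Fin (K + 1)) (κ r).succ) then (1 : ℝ) else 0)
            - (if D' = Bset r D then (1 : ℝ) else 0)) := by
  by_cases h0 : (0 : Fin (K + 1)) ∈ D
  · by_cases hl : (κ r).succ ∈ D
    · have hγ0 : ∀ z : Fin (K + 1) → S, γ r (z, D) = 0 := fun z => by
        rw [hγ]; dsimp only; rw [if_neg (not_not.mpr h0), if_neg (not_not.mpr hl)]
      simp_rw [hγ0, mul_zero, sum_const_zero, zero_mul]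
      rw [hg, if_neg (not_not.mpr h0), if_neg (not_not.mpr hl)]; ring
    · have hγc : ∀ z : Fin (K + 1) → S, γ r (z, D) = β' r z := fun z => by
        rw [hγ]; dsimp only; rw [if_neg (not_not.mpr h0), if_pos hl]
      simp_rw [hγc]
      rw [fresh_sum_regenWeight' κ φ hμ hμ1 hβ' r (fun z v => hlam z _ v hl), hg, if_neg (not_not.mpr h0), if_pos hl]
  · by_cases hl : (κ r).succ ∈ D
    · have hγb : ∀ z : Fin (K + 1) → S, γ r (z, D) = β r z := fun z => by
        rw [hγ]; dsimp only; rw [if_pos h0, if_neg (not_not.mpr hl)]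
      simp_rw [hγb]
      rw [fresh_sum_regenWeight κ φ hμ hμ1 hβ (fun z v => hlam z 0 v h0) r, hg, if_pos h0, if_neg (not_not.mpr hl)]
    · -- both clean: `σD = D = BD`, the bracket vanishes
      rw [swapImage_eq_self κ r h0 hl, hB, if_pos (show (0 : Fin (K + 1)) ∉ D ∧ (κ r).succ ∉ D from ⟨h0, hl⟩),
        sub_self, mul_zero, mul_zero]

/-- `Σ_{z'} 𝟙{z' = y ∧ P} = 𝟙{P}`. [ours] -/
theorem sum_ite_eqAnd_one (y : Fin (K + 1) → S) (P : Prop) [Decidable P] :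
    ∑ z' : Fin (K + 1) → S, (if z' = y ∧ P then (1 : ℝ) else 0) = if P then (1 : ℝ) else 0 := by
  by_cases hP : P
  · simp_rw [hP, and_true, if_true]; rw [Finset.sum_ite_eq' univ y, if_pos (mem_univ _)]
  · simp_rw [hP, and_false, if_false]; exact sum_const_zero

/-- **THE TAG MARGINAL OF A FRESH LAW MOVES BY THE REGENERATION TAG CHAIN:**
`Σ_{z'} (λP̂)(z', D') = Σ_D (Σ_z λ(z,D))·Q(D,D')` (`w` a probability vector, `M_k` row-stochastic, unit-mass laws).
[ours] -/
theorem dom_tag_step (hμ : ∀ k x, 0 < μ k x) (hμ1 : ∀ k, ∑ u, μ k u = 1) (hM : ∀ k, IsRowStochastic (M k))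
    (hw1 : ∑ k, w k = 1)
    {α : Fin m → (Fin (K + 1) → S) → ℝ}
    {β : Fin m → (Fin (K + 1) → S) → ℝ} (hβ : ∀ r z, β r z = p * μ (κ r).succ (φ r (z 0)) / μ 0 (z 0))
    {β' : Fin m → (Fin (K + 1) → S) → ℝ}
    (hβ' : ∀ r z, β' r z = q * μ 0 ((φ r).symm (z (κ r).succ)) / μ (κ r).succ (z (κ r).succ))
    {γ : Fin m → (Fin (K + 1) → S) × Finset (Fin (K + 1)) → ℝ}
    (hγ : ∀ r a, γ r a = if (0 : Fin (K + 1)) ∉ a.2 then (if (κ r).succ ∉ a.2 then α r a.1 else β r a.1)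
      else (if (κ r).succ ∉ a.2 then β' r a.1 else 0))
    {gbar : Fin m → Finset (Fin (K + 1)) → ℝ}
    (hg : ∀ r D, gbar r D = if (0 : Fin (K + 1)) ∉ D then (if (κ r).succ ∉ D then (1 : ℝ) else p)
      else (if (κ r).succ ∉ D then q else 0))
    {Bset : Fin m → Finset (Fin (K + 1)) → Finset (Fin (K + 1))}
    (hB : ∀ r D, Bset r D = if (0 : Fin (K + 1)) ∉ D ∧ (κ r).succ ∉ D then D
      else insert (0 : Fin (K + 1)) (insert (κ r).succ D))
    {Ph : (Fin (K + 1) → S) × Finset (Fin (K + 1)) → (Fin (K + 1) → S) × Finset (Fin (K + 1)) → ℝ}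
    (hPh : ∀ a b, Ph a b = ∑ r : Fin m, t / m *
        (γ r a * (if b.1 = edgeFlowSwap (φ r) 0 (κ r).succ a.1 ∧ b.2 = a.2.image (Equiv.swap (0 : Fin (K + 1)) (κ r).succ)
            then (1 : ℝ) else 0)
          + (α r a.1 - γ r a) * (if b.1 = edgeFlowSwap (φ r) 0 (κ r).succ a.1 ∧ b.2 = Bset r a.2 then (1 : ℝ) else 0)
          + (1 - α r a.1) * (if b.1 = a.1 ∧ b.2 = Bset r a.2 then (1 : ℝ) else 0))
      + (1 - t) * ∑ k : Fin (K + 1), w k * (coordKernel M k a.1 b.1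
          * (if b.2 = (if k = 0 then a.2.erase 0 else a.2) then (1 : ℝ) else 0)))
    {Q : Finset (Fin (K + 1)) → Finset (Fin (K + 1)) → ℝ}
    (hQ : ∀ D D', Q D D' = ∑ r : Fin m, t / m *
        (gbar r D * (if D' = D.image (Equiv.swap (0 : Fin (K + 1)) (κ r).succ) then (1 : ℝ) else 0)
          + (1 - gbar r D) * (if D' = Bset r D then (1 : ℝ) else 0))
      + (1 - t) * (w 0 * (if D' = D.erase 0 then (1 : ℝ) else 0) + (1 - w 0) * (if D' = D then (1 : ℝ) else 0)))
    {lam : (Fin (K + 1) → S) × Finset (Fin (K + 1)) → ℝ}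
    (hlam : ∀ (z : Fin (K + 1) → S) (D : Finset (Fin (K + 1))) (j : Fin (K + 1)) (v : S), j ∉ D →
      lam (update z j v, D) * μ j (z j) = lam (z, D) * μ j v)
    (D' : Finset (Fin (K + 1))) :
    ∑ z' : Fin (K + 1) → S, stepLaw Ph lam (z', D') = ∑ D : Finset (Fin (K + 1)), (∑ z, lam (z, D)) * Q D D' := by
  -- row sums of `P̂` over the configuration: the tag kernel given `(z, D)`
  have hone : ∀ (k : Fin (K + 1)) (z : Fin (K + 1) → S), ∑ z' : Fin (K + 1) → S, coordKernel M k z z' = 1 := by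
    intro k z
    have h := sum_coordKernel_mul M k z (fun _ => (1 : ℝ))
    simp only [mul_one] at h
    rw [h, (hM k).2]
  have hw0' : ∑ i : Fin K, w i.succ = 1 - w 0 := by
    rw [Fin.sum_univ_succ] at hw1; linarith
  have hrow : ∀ (z : Fin (K + 1) → S) (D : Finset (Fin (K + 1))), ∑ z' : Fin (K + 1) → S, Ph (z, D) (z', D')
      = ∑ r : Fin m, t / m * (γ r (z, D) * ((if D' = D.image (Equiv.swap (0 : Fin (K + 1)) (κ r).succ) then (1 : ℝ) else 0)
            - (if D' = Bset r D then (1 : ℝ) else 0)) + (if D' = Bset r D then (1 : ℝ) else 0))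
        + (1 - t) * (w 0 * (if D' = D.erase 0 then (1 : ℝ) else 0) + (1 - w 0) * (if D' = D then (1 : ℝ) else 0)) := by
    intro z D
    simp_rw [hPh]
    rw [Finset.sum_add_distrib]
    congr 1
    · rw [Finset.sum_comm]
      refine sum_congr rfl fun r _ => ?_
      rw [← Finset.mul_sum, Finset.sum_add_distrib, Finset.sum_add_distrib, ← Finset.mul_sum, ← Finset.mul_sum,
        ← Finset.mul_sum]
      simp only [ite_and, Finset.sum_ite_eq', Finset.mem_univ, if_true]
      ring
    · rw [← Finset.mul_sum]
      congr 1
      rw [Finset.sum_comm]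
      simp_rw [← Finset.mul_sum, ← Finset.sum_mul, hone, one_mul]
      rw [Fin.sum_univ_succ, if_pos rfl]
      simp_rw [if_neg (Fin.succ_ne_zero _)]
      rw [← Finset.sum_mul, hw0']
  -- integrate `λ` against the row sums, tag class by tag class
  unfold stepLaw
  rw [Finset.sum_comm]
  simp_rw [← Finset.mul_sum]
  rw [Fintype.sum_prod_type]
  simp_rw [hrow]
  rw [Finset.sum_comm]
  refine sum_congr rfl fun D _ => ?_
  have hsplit : ∀ z : Fin (K + 1) → S, lam (z, D) * (∑ r : Fin m, t / m * (γ r (z, D)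
        * ((if D' = D.image (Equiv.swap (0 : Fin (K + 1)) (κ r).succ) then (1 : ℝ) else 0)
            - (if D' = Bset r D then (1 : ℝ) else 0)) + (if D' = Bset r D then (1 : ℝ) else 0))
        + (1 - t) * (w 0 * (if D' = D.erase 0 then (1 : ℝ) else 0) + (1 - w 0) * (if D' = D then (1 : ℝ) else 0)))
      = (∑ r : Fin m, (t / m * ((if D' = D.image (Equiv.swap (0 : Fin (K + 1)) (κ r).succ) then (1 : ℝ) else 0)
            - (if D' = Bset r D then (1 : ℝ) else 0)) * (lam (z, D) * γ r (z, D))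
          + t / m * (if D' = Bset r D then (1 : ℝ) else 0) * lam (z, D)))
        + (1 - t) * (w 0 * (if D' = D.erase 0 then (1 : ℝ) else 0) + (1 - w 0) * (if D' = D then (1 : ℝ) else 0))
          * lam (z, D) := by
    intro z
    rw [mul_add, Finset.mul_sum]
    congr 1
    · exact sum_congr rfl fun r _ => by ring
    · ring
  rw [sum_congr rfl (fun z _ => hsplit z), Finset.sum_add_distrib]
  have part2 : ∑ z : Fin (K + 1) → S, (1 - t) * (w 0 * (if D' = D.erase 0 then (1 : ℝ) else 0)
        + (1 - w 0) * (if D' = D then (1 : ℝ) else 0)) * lam (z, D)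
      = (1 - t) * (w 0 * (if D' = D.erase 0 then (1 : ℝ) else 0) + (1 - w 0) * (if D' = D then (1 : ℝ) else 0))
        * ∑ z : Fin (K + 1) → S, lam (z, D) := by rw [Finset.mul_sum]
  have part1 : ∑ z : Fin (K + 1) → S, ∑ r : Fin m,
        (t / m * ((if D' = D.image (Equiv.swap (0 : Fin (K + 1)) (κ r).succ) then (1 : ℝ) else 0)
            - (if D' = Bset r D then (1 : ℝ) else 0)) * (lam (z, D) * γ r (z, D))
          + t / m * (if D' = Bset r D then (1 : ℝ) else 0) * lam (z, D))
      = ∑ r : Fin m, (t / m * ((if D' = D.image (Equiv.swap (0 : Fin (K + 1)) (κ r).succ) then (1 : ℝ) else 0)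
            - (if D' = Bset r D then (1 : ℝ) else 0)) * ∑ z, lam (z, D) * γ r (z, D)
          + t / m * (if D' = Bset r D then (1 : ℝ) else 0) * ∑ z, lam (z, D)) := by
    rw [Finset.sum_comm]
    refine sum_congr rfl fun r _ => ?_
    rw [Finset.sum_add_distrib, ← Finset.mul_sum, ← Finset.mul_sum]
  rw [part1, part2]
  have hgw := fun r => fresh_goodWeight_sum κ φ hμ hμ1 hβ hβ' hγ hg hB (fun z j v hj => hlam z D j v hj) r D'
  rw [sum_congr rfl (fun r _ => show t / m * ((if D' = D.image (Equiv.swap (0 : Fin (K + 1)) (κ r).succ) then (1 : ℝ)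
        else 0) - (if D' = Bset r D then (1 : ℝ) else 0)) * ∑ z, lam (z, D) * γ r (z, D)
        + t / m * (if D' = Bset r D then (1 : ℝ) else 0) * ∑ z, lam (z, D)
      = (∑ z, lam (z, D)) * (t / m * (gbar r D * (if D' = D.image (Equiv.swap (0 : Fin (K + 1)) (κ r).succ) then (1 : ℝ)
        else 0) + (1 - gbar r D) * (if D' = Bset r D then (1 : ℝ) else 0))) by
      have h := hgw r
      calc t / m * ((if D' = D.image (Equiv.swap (0 : Fin (K + 1)) (κ r).succ) then (1 : ℝ) else 0)
              - (if D' = Bset r D then (1 : ℝ) else 0)) * ∑ z, lam (z, D) * γ r (z, D)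
            + t / m * (if D' = Bset r D then (1 : ℝ) else 0) * ∑ z, lam (z, D)
          = t / m * ((∑ z, lam (z, D) * γ r (z, D))
              * ((if D' = D.image (Equiv.swap (0 : Fin (K + 1)) (κ r).succ) then (1 : ℝ) else 0)
                - (if D' = Bset r D then (1 : ℝ) else 0)))
            + t / m * (if D' = Bset r D then (1 : ℝ) else 0) * ∑ z, lam (z, D) := by ring
        _ = t / m * (gbar r D * (∑ z, lam (z, D))
              * ((if D' = D.image (Equiv.swap (0 : Fin (K + 1)) (κ r).succ) then (1 : ℝ) else 0)
                - (if D' = Bset r D then (1 : ℝ) else 0)))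
            + t / m * (if D' = Bset r D then (1 : ℝ) else 0) * ∑ z, lam (z, D) := by rw [h]
        _ = _ := by ring),
    ← Finset.mul_sum, hQ]
  ring

/-! ## §2 The tag marginal, the empty tag, minorisation -/

/-- **FROM `δ_{(x, univ)}` THE TAG MARGINAL AT TIME `n` IS `δ_{univ} Qⁿ`** (exact hot sampler, stationary cold kernels,
unit-mass positive laws, `w` a probability vector). [ours] -/
theorem dom_lawAt_snd (hμ : ∀ k x, 0 < μ k x) (hμ1 : ∀ k, ∑ u, μ k u = 1) (hM : ∀ k, IsRowStochastic (M k))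
    (hM0 : ∀ u v, M 0 u v = μ 0 v) (hstat : ∀ k : Fin (K + 1), k ≠ 0 → ∀ v, ∑ u, μ k u * M k u v = μ k v)
    (hw1 : ∑ k, w k = 1)
    {α : Fin m → (Fin (K + 1) → S) → ℝ}
    (hα : ∀ r z, α r z = min 1 (tensorFun μ (edgeFlowSwap (φ r) 0 (κ r).succ z) / tensorFun μ z))
    {β : Fin m → (Fin (K + 1) → S) → ℝ} (hβ : ∀ r z, β r z = p * μ (κ r).succ (φ r (z 0)) / μ 0 (z 0))
    {β' : Fin m → (Fin (K + 1) → S) → ℝ}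
    (hβ' : ∀ r z, β' r z = q * μ 0 ((φ r).symm (z (κ r).succ)) / μ (κ r).succ (z (κ r).succ))
    {γ : Fin m → (Fin (K + 1) → S) × Finset (Fin (K + 1)) → ℝ}
    (hγ : ∀ r a, γ r a = if (0 : Fin (K + 1)) ∉ a.2 then (if (κ r).succ ∉ a.2 then α r a.1 else β r a.1)
      else (if (κ r).succ ∉ a.2 then β' r a.1 else 0))
    {gbar : Fin m → Finset (Fin (K + 1)) → ℝ}
    (hg : ∀ r D, gbar r D = if (0 : Fin (K + 1)) ∉ D then (if (κ r).succ ∉ D then (1 : ℝ) else p)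
      else (if (κ r).succ ∉ D then q else 0))
    {Bset : Fin m → Finset (Fin (K + 1)) → Finset (Fin (K + 1))}
    (hB : ∀ r D, Bset r D = if (0 : Fin (K + 1)) ∉ D ∧ (κ r).succ ∉ D then D
      else insert (0 : Fin (K + 1)) (insert (κ r).succ D))
    {Ph : (Fin (K + 1) → S) × Finset (Fin (K + 1)) → (Fin (K + 1) → S) × Finset (Fin (K + 1)) → ℝ}
    (hPh : ∀ a b, Ph a b = ∑ r : Fin m, t / m *
        (γ r a * (if b.1 = edgeFlowSwap (φ r) 0 (κ r).succ a.1 ∧ b.2 = a.2.image (Equiv.swap (0 : Fin (K + 1)) (κ r).succ)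
            then (1 : ℝ) else 0)
          + (α r a.1 - γ r a) * (if b.1 = edgeFlowSwap (φ r) 0 (κ r).succ a.1 ∧ b.2 = Bset r a.2 then (1 : ℝ) else 0)
          + (1 - α r a.1) * (if b.1 = a.1 ∧ b.2 = Bset r a.2 then (1 : ℝ) else 0))
      + (1 - t) * ∑ k : Fin (K + 1), w k * (coordKernel M k a.1 b.1
          * (if b.2 = (if k = 0 then a.2.erase 0 else a.2) then (1 : ℝ) else 0)))
    {Q : Finset (Fin (K + 1)) → Finset (Fin (K + 1)) → ℝ}
    (hQ : ∀ D D', Q D D' = ∑ r : Fin m, t / m *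
        (gbar r D * (if D' = D.image (Equiv.swap (0 : Fin (K + 1)) (κ r).succ) then (1 : ℝ) else 0)
          + (1 - gbar r D) * (if D' = Bset r D then (1 : ℝ) else 0))
      + (1 - t) * (w 0 * (if D' = D.erase 0 then (1 : ℝ) else 0) + (1 - w 0) * (if D' = D then (1 : ℝ) else 0)))
    (x : Fin (K + 1) → S) (n : ℕ) (D : Finset (Fin (K + 1))) :
    ∑ z : Fin (K + 1) → S, lawAt Ph (Pi.single (x, (univ : Finset (Fin (K + 1)))) 1) n (z, D)
      = lawAt Q (Pi.single (univ : Finset (Fin (K + 1))) 1) n D := by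
  induction n generalizing D with
  | zero =>
    rw [lawAt_zero, lawAt_zero, ← sum_filter_prodSnd_eq (fun b => (Pi.single (x, (univ : Finset (Fin (K + 1)))) (1 : ℝ)
      : _ → ℝ) b) D]
    exact sum_filter_prodSnd_single x univ D
  | succ n ih =>
    rw [lawAt_succ, lawAt_succ,
      dom_tag_step κ φ hμ hμ1 hM hw1 hβ hβ' hγ hg hB hPh hQ (dom_fresh_lawAt κ φ hμ hM0 hstat hα hβ hβ' hγ hB hPh x n) D]
    unfold stepLaw
    exact sum_congr rfl fun D₀ _ => by rw [ih D₀]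

end Minor

end Summit.Ventures.LatticeQCDFlow.Scaling

end
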